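/-
Copyright (c) 2026 the pub-hodgecm-mathlib formalisation cell (harness21).  Prover seat hodgecm-mathlib-LH10-p01 (g3): line LH4 (dyadic pay-down of `stub_N6nsDyadic`),
organ (D-SH), brick (R-dy) «RAO REGULAR CLASS AT A DYADIC PLACE», FILE 2 (LH4-plan (g3) DEALER WORD #1); the proof body is ★ p849367's (F0P3a-p09 (g4)) verbatim; 2026-09-02.
-/
import Literature.NumberTheory.Rogawski1990.UnipotentLevelPiecesFrameCM                   -- ★ the one-place frame `ψ` at `T` (`exists_conj_localNonsplitEquiv_eq`, `mem_cmLocalIntegralLevel_iff_isIntMatrix_conj`, `continuous_conj_localNonsplitEquiv_apply`)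
import Literature.NumberTheory.Automorphic.UnitaryThreeRegularUnipotentOrbitFrame         -- ★ p849269∕p849290 REG-FRAME (LH4-p02): `exists_transversal_mul_regCent_of_mem`, `coe_torusElt_zpow`, `coe_transversal_conj_regularUnipotent`, `coe_diagonal_conj_upperTriangularUnipotent`, `regCentElt_mem_and_commute`
import Literature.NumberTheory.Automorphic.UnitaryThreeUnipotentCentralizers                -- ★ `diagonal_mem_unitaryGroupOfForm_three_iff`
import Literature.NumberTheory.Automorphic.UnitaryGroupCMLocalIwasawa                       -- ★ `exists_mem_cmLocalIntegralLevel_mul_borel` (`G = K·B`, every finite place)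
import Literature.NumberTheory.Automorphic.FiniteAdeleFactorizable                           -- ★ `isClopen_setOf_valued_le`
import Literature.NumberTheory.Rogawski1990.UnipotentOrbitalIntegralConvergenceTransvectionCM  -- ★ p849314 (this seat): `diag_rel_of_upper_mem_unitaryGroupOfForm` (§1 field lemmas)
import HarnessLib

/-!
# The CARRIER COVERING at the regular unipotent base point of `U(Φ₃)(L⁺_v)` at an ARBITRARY non-split place (dyadic included):
# `{y ∣ y u₀ y⁻¹ ∈ C} ⊆ ⋃_j K · ψ⁻¹(d^j · m_κ · n(a,s))` with bounded levels (Ranga Rao's theorem for `U(3)`, regular class, step (I′))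

Topic `NumberTheory/Rogawski1990`; namespace `Literature.NumberTheory.Rogawski1990`.  THEOREMS ONLY (no definition, no instance, no notation, no named fact, no `sorry`);
MEASURE-FREE.  Cell `pub/hodgecm-mathlib` (D-0151), crux H413 = `stmt-HodgeConjecture-24833`, F0∕P3c line LH4, the DYADIC pay-down of the closer row `stub_N6nsDyadic`
(LH4-plan (g3)), organ (D-SH) «Shalika at `Φ₃` at dyadic non-split places», brick (R-dy) «RAO REGULAR CLASS AT A DYADIC PLACE», FILE 2 of 4 (seat LH10-p01 (g3)).
This is ★ (I) p849367 `UnipotentOrbitCoveringRegularCM` :: `UnitaryGroup.exists_cover_of_regular_basePoint` (F0P3a-p09 (g4)) with its ONE idle hypothesis removed: the ★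
proof uses `2 ∈ 𝒪_w^×` only through `(2 : L_w) ≠ 0`, which holds at every place (`L_w ⊇ L ⊇ ℚ`); statement and proof are otherwise the ★ text token for token
(census `DYADIC-CENSUS.v1.md` §6 (I): «`h2K` (:104) COSMETIC»).  The `2`-SENSITIVE steps of the regular road live downstream (FILE 1 ★-cand
`UnitaryThreeRegularUnipotentOrbitFrameDyadic`: coset criterion ∕ absorption with `v 2 = exp(−c₂)`; FILE 3 shells).

THE MATHEMATICS (= ★ (I)).  `G = U(Φ₃)(L⁺_v)` at a non-split `v` (`w ∣ v` fixed by complex conjugation), one-place model `ψ : G ≃ U(σ, J₀)(L_w)` (★ `localNonsplitEquiv`,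
frame `T = 1`), `K = U(Φ₃)(𝒪_v)`; a uniformiser `z` of `L_w`, a non-zero skew `ξ`, `d = diag(z, 1, (σz)⁻¹)`, the regular base point `γ₀ = ψ⁻¹ u₀`,
`u₀ = !![1, 1, −t₀; 0, 1, −1; 0, 0, 1]`.  For `y` with `y γ₀ y⁻¹ ∈ C` (`C` compact): Iwasawa `y = κ b`, `ψ b = D · m_κ · n(a,s)` (★ REG-FRAME), `D = k′ d^j` with `k′` integral,
and the entry bounds on the compact `ψ(K C K)` give `−R₁ ≤ j`, `|t₀ + 2κξ| ≤ exp(R₂ + 2j)`.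

* `UnitaryGroup.exists_cover_of_regular_basePoint'` — THE EXPORT (I′): ★ (I)'s text with the binder `(h2 : IsUnit (2 : 𝒪[L_w]))` deleted.
HONEST LABEL: count-neutral ★ brick (`--supports stmt-HodgeConjecture-24833`), pays no letter by itself; HC_CM is proved only modulo the 7 printed citations (2 remaining:
hLiu418 = stmt-HodgeConjecture-24832, h413 = stmt-HodgeConjecture-24833) until rung 0 closes.

## References
* [Rao1972] R. Ranga Rao, *Orbital integrals in reductive groups*, Ann. of Math. (2) 96 (1972) 505–510, Theorem p. 505.
* [Rogawski1990] J. D. Rogawski, *Automorphic Representations of Unitary Groups in Three Variables*, Ann. of Math. Stud. 123 (1990): §1.10 p. 9, §3.9 Prop. 3.9.1 p. 32, §4.9 p. 54,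
  §8.1 p. 112.
* [BruhatTits1972] F. Bruhat, J. Tits, *Groupes réductifs sur un corps local I*, Publ. Math. IHÉS 41 (1972), (4.4.3).
-/

set_option autoImplicit false

noncomputable section

open scoped Matrix MatrixGroups WithZero ValuativeRel Pointwise
open Matrix Topology Set NumberField IsDedekindDomain

namespace Literature.NumberTheory.Rogawski1990

open Literature.NumberTheory.Automorphic Literature.NumberTheory.Automorphic.UnitaryGroup Literature.NumberTheory.GaloisRepresentations
open Literature.NumberTheory.Automorphic.UnitaryLatticeTree Literature.NumberTheory.Automorphic.HermitianLattice

set_option maxHeartbeats 3200000 in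
/-- = ★ `UnitaryGroup.exists_cover_of_regular_basePoint` with the hypothesis `2 ∈ 𝒪_w^×` deleted.
**THE CARRIER COVERING AT THE REGULAR BASE POINT (RAO-CONV, regular class, step (I′), every residue characteristic).**  At an ARBITRARY non-split place (no hypothesis on `2`; ★ (I) is the same text with `2 ∈ 𝒪_w^×`), for a uniformiser `z`, a non-zero skew `ξ`,
`d = diag(z, 1, (σz)⁻¹)` and the regular base point `γ₀` (`ψγ₀ = u₀ = !![1,1,−t₀;0,1,−1;0,0,1]`): there are `R₁ R₂ : ℤ` such that every `y` with `y γ₀ y⁻¹` in the compact `C` is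
`k · y₁` with `k ∈ K = U(Φ₃)(𝒪_v)`, `ψ y₁ = d^j · m_κ · n(a,s)` (`σκ = κ`, `σa = a`, `σs = −s`), `−R₁ ≤ j` and `|t₀ + 2κξ| ≤ exp(R₂ + 2j)` — Iwasawa `G = K·B` used
set-theoretically, the diagonal of `ψ b` split off as `k′ d^j` with `k′` integral, ★ REG-FRAME's `N′ = m_κ n(a,s)`, and the entry bounds on `ψ(K C K)`.
[cite: Rao1972, Theorem p. 505] [cite: Rogawski1990, §3.9 Prop. 3.9.1 p. 32; §4.9 p. 54; §8.1 p. 112] [cite: BruhatTits1972, (4.4.3)] -/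
theorem UnitaryGroup.exists_cover_of_regular_basePoint'
    (L : Type) [Field L] [NumberField L] [IsCMField L] (v : HeightOneSpectrum (𝓞 ↥(maximalRealSubfield L)))
    (w : PlacesOver L v) (hw : IsCMField.complexConj L • w.1 = w.1)
    {z ξ t₀ : (w.1.adicCompletion L)} (hz : Valued.v z = WithZero.exp (-1 : ℤ)) (hξ : (galAdicCompletionMap (L := L) (IsCMField.complexConj L) hw) ξ = -ξ) (hξ0 : ξ ≠ 0)
    {d : GL (Fin 3) (w.1.adicCompletion L)} (hd : (d : Matrix (Fin 3) (Fin 3) (w.1.adicCompletion L)) = Matrix.diagonal ![z, 1, ((galAdicCompletionMap (L := L) (IsCMField.complexConj L) hw) z)⁻¹])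
    (γ₀ : ((cmDatum L 3 (Matrix.of fun i j : Fin 3 => if i.val + j.val + 1 = 3 then (1 : L) else 0)).Local v)) (hγ₀ : (((localNonsplitEquiv (IsCMField.complexConj L) (Matrix.of fun i j : Fin 3 => if i.val + j.val + 1 = 3 then (1 : L) else 0) (IsCMField.complexConj_ne_one L) w hw γ₀ : ↥(unitaryGroupOfForm (galAdicCompletionMap (L := L) (IsCMField.complexConj L) hw) (placeForm (Matrix.of fun i j : Fin 3 => if i.val + j.val + 1 = 3 then (1 : L) else 0) w.1))) : GL (Fin 3) (w.1.adicCompletion L)) : Matrix (Fin 3) (Fin 3) (w.1.adicCompletion L)) = !![1, 1, -t₀; 0, 1, -1; 0, 0, 1])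
    (C : Set ((cmDatum L 3 (Matrix.of fun i j : Fin 3 => if i.val + j.val + 1 = 3 then (1 : L) else 0)).Local v)) (hC : IsCompact C) :
    ∃ R₁ R₂ : ℤ, ∀ y : ((cmDatum L 3 (Matrix.of fun i j : Fin 3 => if i.val + j.val + 1 = 3 then (1 : L) else 0)).Local v), y * γ₀ * y⁻¹ ∈ C →
      ∃ (k y₁ : ((cmDatum L 3 (Matrix.of fun i j : Fin 3 => if i.val + j.val + 1 = 3 then (1 : L) else 0)).Local v)) (j : ℤ) (κ a s : (w.1.adicCompletion L)) (m n : GL (Fin 3) (w.1.adicCompletion L)),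
        k ∈ cmLocalIntegralLevel L 3 (Matrix.of fun i j : Fin 3 => if i.val + j.val + 1 = 3 then (1 : L) else 0) v ∧ y = k * y₁ ∧ ((localNonsplitEquiv (IsCMField.complexConj L) (Matrix.of fun i j : Fin 3 => if i.val + j.val + 1 = 3 then (1 : L) else 0) (IsCMField.complexConj_ne_one L) w hw y₁ : ↥(unitaryGroupOfForm (galAdicCompletionMap (L := L) (IsCMField.complexConj L) hw) (placeForm (Matrix.of fun i j : Fin 3 => if i.val + j.val + 1 = 3 then (1 : L) else 0) w.1))) : GL (Fin 3) (w.1.adicCompletion L)) = d ^ j * m * n ∧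
        (m : Matrix (Fin 3) (Fin 3) (w.1.adicCompletion L)) = !![1, κ * ξ, κ ^ 2 * ξ ^ 2 / 2; 0, 1, κ * ξ; 0, 0, 1] ∧
        (n : Matrix (Fin 3) (Fin 3) (w.1.adicCompletion L)) = !![1, a, s - a ^ 2 / 2; 0, 1, -a; 0, 0, 1] ∧
        (galAdicCompletionMap (L := L) (IsCMField.complexConj L) hw) κ = κ ∧ (galAdicCompletionMap (L := L) (IsCMField.complexConj L) hw) a = a ∧ (galAdicCompletionMap (L := L) (IsCMField.complexConj L) hw) s = -s ∧ -R₁ ≤ j ∧ Valued.v (t₀ + 2 * κ * ξ) ≤ WithZero.exp (R₂ + 2 * j) := by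
  classical
  -- ## 0. The frame `ψ = e` and its dictionary (as in ★ p849314)
  have hT : placeForm (Matrix.of fun i j : Fin 3 => if i.val + j.val + 1 = 3 then (1 : L) else 0) w.1 = formCongr (galAdicCompletionMap (L := L) (IsCMField.complexConj L) hw) (1 : GL (Fin 3) (w.1.adicCompletion L)) ((StdForm.antidiagonal 3).over (w.1.adicCompletion L)) := by
    rw [placeForm_antidiagOne]; simp [formCongr, Matrix.map_one]
  have hTint : (1 : GL (Fin 3) (w.1.adicCompletion L)) ∈ glInt 3 (w.1.adicCompletion L) := Subgroup.one_mem _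
  obtain ⟨ψ, hψ⟩ : ∃ ψ : ((cmDatum L 3 (Matrix.of fun i j : Fin 3 => if i.val + j.val + 1 = 3 then (1 : L) else 0)).Local v) → GL (Fin 3) (w.1.adicCompletion L), ∀ y, ψ y = 1 * ((localNonsplitEquiv (IsCMField.complexConj L) (Matrix.of fun i j : Fin 3 => if i.val + j.val + 1 = 3 then (1 : L) else 0) (IsCMField.complexConj_ne_one L) w hw y : ↥(unitaryGroupOfForm (galAdicCompletionMap (L := L) (IsCMField.complexConj L) hw) (placeForm (Matrix.of fun i j : Fin 3 => if i.val + j.val + 1 = 3 then (1 : L) else 0) w.1))) : GL (Fin 3) (w.1.adicCompletion L)) * 1⁻¹ := ⟨_, fun _ => rfl⟩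
  have hψe : ∀ y, ψ y = ((localNonsplitEquiv (IsCMField.complexConj L) (Matrix.of fun i j : Fin 3 => if i.val + j.val + 1 = 3 then (1 : L) else 0) (IsCMField.complexConj_ne_one L) w hw y : ↥(unitaryGroupOfForm (galAdicCompletionMap (L := L) (IsCMField.complexConj L) hw) (placeForm (Matrix.of fun i j : Fin 3 => if i.val + j.val + 1 = 3 then (1 : L) else 0) w.1))) : GL (Fin 3) (w.1.adicCompletion L)) := fun y => by rw [hψ, one_mul, inv_one, mul_one]
  have hψU : ∀ y, ψ y ∈ unitaryGroupOfForm (galAdicCompletionMap (L := L) (IsCMField.complexConj L) hw) ((StdForm.antidiagonal 3).over (w.1.adicCompletion L)) :=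
    fun y => by rw [hψ]; exact conj_localNonsplitEquiv_mem L _ v w hw hT y
  have hψmul : ∀ y y', ψ (y * y') = ψ y * ψ y' := fun y y' => by simp only [hψ]; exact conj_localNonsplitEquiv_mul L _ v w hw y y'
  have hψinv : ∀ y, ψ y⁻¹ = (ψ y)⁻¹ := fun y => by simp only [hψ]; exact conj_localNonsplitEquiv_inv L _ v w hw y
  have hψsurj : ∀ g ∈ unitaryGroupOfForm (galAdicCompletionMap (L := L) (IsCMField.complexConj L) hw) ((StdForm.antidiagonal 3).over (w.1.adicCompletion L)), ∃ y, ψ y = g :=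
    fun g hg => by simp only [hψ]; exact exists_conj_localNonsplitEquiv_eq L _ v w hw hT hg
  have hψK : ∀ y, y ∈ cmLocalIntegralLevel L 3 (Matrix.of fun i j : Fin 3 => if i.val + j.val + 1 = 3 then (1 : L) else 0) v ↔ IsIntMatrix ((ψ y : GL (Fin 3) (w.1.adicCompletion L)) : Matrix (Fin 3) (Fin 3) (w.1.adicCompletion L)) :=
    fun y => by rw [hψ]; exact mem_cmLocalIntegralLevel_iff_isIntMatrix_conj L _ v w hw hT hTint y
  have hψcont : ∀ a b, Continuous fun y => ((ψ y : GL (Fin 3) (w.1.adicCompletion L)) : Matrix (Fin 3) (Fin 3) (w.1.adicCompletion L)) a b := fun a b => by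
    simp only [hψ]; exact continuous_conj_localNonsplitEquiv_apply L _ v w hw a b
  have hψentry : ∀ (y : ((cmDatum L 3 (Matrix.of fun i j : Fin 3 => if i.val + j.val + 1 = 3 then (1 : L) else 0)).Local v)) (a b : Fin 3), ((ψ y : GL (Fin 3) (w.1.adicCompletion L)) : Matrix (Fin 3) (Fin 3) (w.1.adicCompletion L)) a b =
      (((y.val : GL (Fin 3) (UnitaryGroup.LocalRing L v)) : Matrix (Fin 3) (Fin 3) (UnitaryGroup.LocalRing L v)) a b) w := by
    intro y a b; rw [hψe, coe_coe_localNonsplitEquiv_apply]; rfl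
  have hψγ₀ : ((ψ γ₀ : GL (Fin 3) (w.1.adicCompletion L)) : Matrix (Fin 3) (Fin 3) (w.1.adicCompletion L)) = !![1, 1, -t₀; 0, 1, -1; 0, 0, 1] := by rw [hψe]; exact hγ₀
  -- the local field data
  have hcc : IsCMField.complexConj L * IsCMField.complexConj L = 1 := AlgEquiv.ext fun y => IsCMField.complexConj_apply_apply L y
  have hσσ : ∀ x : (w.1.adicCompletion L), (galAdicCompletionMap (L := L) (IsCMField.complexConj L) hw) ((galAdicCompletionMap (L := L) (IsCMField.complexConj L) hw) x) = x :=
    fun x => Literature.NumberTheory.Automorphic.Liu2021.galAdicCompletionMap_galAdicCompletionMap_self _ L (IsCMField.complexConj L) hcc hw x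
  have hvσ : ∀ x : (w.1.adicCompletion L), Valued.v ((galAdicCompletionMap (L := L) (IsCMField.complexConj L) hw) x) = Valued.v x := fun x => valued_galAdicCompletionMap (L := L) (IsCMField.complexConj L) hw x
  have h2K : (2 : (w.1.adicCompletion L)) ≠ 0 := by
    rw [← map_ofNat (algebraMap L (w.1.adicCompletion L)) 2]
    exact (map_ne_zero (algebraMap L (w.1.adicCompletion L))).2 two_ne_zero
  have hz0 : z ≠ 0 := fun h => by rw [h, map_zero] at hz; exact WithZero.exp_ne_zero hz.symm
  have hdU : d ∈ unitaryGroupOfForm (galAdicCompletionMap (L := L) (IsCMField.complexConj L) hw) ((StdForm.antidiagonal 3).over (w.1.adicCompletion L)) := torusElt_mem_unitaryGroupOfForm (galAdicCompletionMap (L := L) (IsCMField.complexConj L) hw) hz0 (hσσ z) hd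
  have hexp_of_ne : ∀ {x : (w.1.adicCompletion L)}, x ≠ 0 → ∃ n : ℤ, Valued.v x = WithZero.exp n := fun {x} hx => by
    have h0 : Valued.v x ≠ 0 := (Valuation.ne_zero_iff _).2 hx
    obtain ⟨e, he⟩ := WithZero.ne_zero_iff_exists.1 h0
    exact ⟨Multiplicative.toAdd e, by rw [← he]; rfl⟩
  -- ## 1. The entry bound on the compact `K C K`
  obtain ⟨hKc, hKo⟩ := isCompact_isOpen_cmLocalIntegralLevel L 3 (Matrix.of fun i j : Fin 3 => if i.val + j.val + 1 = 3 then (1 : L) else 0) v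
  have hC₁ : IsCompact ((cmLocalIntegralLevel L 3 (Matrix.of fun i j : Fin 3 => if i.val + j.val + 1 = 3 then (1 : L) else 0) v : Set ((cmDatum L 3 (Matrix.of fun i j : Fin 3 => if i.val + j.val + 1 = 3 then (1 : L) else 0)).Local v)) * C * (cmLocalIntegralLevel L 3 (Matrix.of fun i j : Fin 3 => if i.val + j.val + 1 = 3 then (1 : L) else 0) v : Set ((cmDatum L 3 (Matrix.of fun i j : Fin 3 => if i.val + j.val + 1 = 3 then (1 : L) else 0)).Local v))) := (hKc.mul hC).mul hKc
  have hball : ∀ mm : ℤ, IsOpen {x : (w.1.adicCompletion L) | Valued.v x ≤ WithZero.exp mm} := fun mm => (isClopen_setOf_valued_le L w.1 WithZero.exp_ne_zero).isOpen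
  obtain ⟨R, hR⟩ : ∃ R : ℤ, ∀ g ∈ (cmLocalIntegralLevel L 3 (Matrix.of fun i j : Fin 3 => if i.val + j.val + 1 = 3 then (1 : L) else 0) v : Set ((cmDatum L 3 (Matrix.of fun i j : Fin 3 => if i.val + j.val + 1 = 3 then (1 : L) else 0)).Local v)) * C * (cmLocalIntegralLevel L 3 (Matrix.of fun i j : Fin 3 => if i.val + j.val + 1 = 3 then (1 : L) else 0) v : Set ((cmDatum L 3 (Matrix.of fun i j : Fin 3 => if i.val + j.val + 1 = 3 then (1 : L) else 0)).Local v)),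
      Valued.v (((ψ g : GL (Fin 3) (w.1.adicCompletion L)) : Matrix (Fin 3) (Fin 3) (w.1.adicCompletion L)) 0 1) ≤ WithZero.exp R ∧
        Valued.v (((ψ g : GL (Fin 3) (w.1.adicCompletion L)) : Matrix (Fin 3) (Fin 3) (w.1.adicCompletion L)) 0 2) ≤ WithZero.exp R := by
    obtain ⟨U, hU⟩ : ∃ U : ℕ → Set ((cmDatum L 3 (Matrix.of fun i j : Fin 3 => if i.val + j.val + 1 = 3 then (1 : L) else 0)).Local v), ∀ mm, U mm =
        (fun y => ((ψ y : GL (Fin 3) (w.1.adicCompletion L)) : Matrix (Fin 3) (Fin 3) (w.1.adicCompletion L)) 0 1) ⁻¹' {x : (w.1.adicCompletion L) | Valued.v x ≤ WithZero.exp (mm : ℤ)} ∩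
          (fun y => ((ψ y : GL (Fin 3) (w.1.adicCompletion L)) : Matrix (Fin 3) (Fin 3) (w.1.adicCompletion L)) 0 2) ⁻¹' {x : (w.1.adicCompletion L) | Valued.v x ≤ WithZero.exp (mm : ℤ)} := ⟨_, fun _ => rfl⟩
    have hUo : ∀ mm, IsOpen (U mm) := fun mm => by
      rw [hU]; exact ((hball mm).preimage (hψcont 0 1)).inter ((hball mm).preimage (hψcont 0 2))
    have hle_of : ∀ x : (w.1.adicCompletion L), ∃ n : ℕ, Valued.v x ≤ WithZero.exp (n : ℤ) := by
      intro x
      rcases eq_or_ne x 0 with h0 | h0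
      · exact ⟨0, by rw [h0, map_zero]; exact zero_le⟩
      · obtain ⟨n, hn⟩ := hexp_of_ne h0
        exact ⟨n.toNat, by rw [hn]; exact WithZero.exp_le_exp.2 (Int.self_le_toNat n)⟩
    have hcov : (cmLocalIntegralLevel L 3 (Matrix.of fun i j : Fin 3 => if i.val + j.val + 1 = 3 then (1 : L) else 0) v : Set ((cmDatum L 3 (Matrix.of fun i j : Fin 3 => if i.val + j.val + 1 = 3 then (1 : L) else 0)).Local v)) * C * (cmLocalIntegralLevel L 3 (Matrix.of fun i j : Fin 3 => if i.val + j.val + 1 = 3 then (1 : L) else 0) v : Set ((cmDatum L 3 (Matrix.of fun i j : Fin 3 => if i.val + j.val + 1 = 3 then (1 : L) else 0)).Local v)) ⊆ ⋃ mm, U mm := by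
      intro g _
      obtain ⟨n₁, hn₁⟩ := hle_of (((ψ g : GL (Fin 3) (w.1.adicCompletion L)) : Matrix (Fin 3) (Fin 3) (w.1.adicCompletion L)) 0 1)
      obtain ⟨n₂, hn₂⟩ := hle_of (((ψ g : GL (Fin 3) (w.1.adicCompletion L)) : Matrix (Fin 3) (Fin 3) (w.1.adicCompletion L)) 0 2)
      refine Set.mem_iUnion.2 ⟨max n₁ n₂, ?_⟩
      rw [hU]
      exact ⟨hn₁.trans (WithZero.exp_le_exp.2 (by exact_mod_cast le_max_left n₁ n₂)),
        hn₂.trans (WithZero.exp_le_exp.2 (by exact_mod_cast le_max_right n₁ n₂))⟩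
    obtain ⟨t, ht⟩ := hC₁.elim_finite_subcover U hUo hcov
    refine ⟨((t.sup id : ℕ) : ℤ), fun g hg => ?_⟩
    obtain ⟨mm, hmm, hgm⟩ := Set.mem_iUnion₂.1 (ht hg)
    rw [hU] at hgm
    have hmono : WithZero.exp (mm : ℤ) ≤ WithZero.exp ((t.sup id : ℕ) : ℤ) := WithZero.exp_le_exp.2 (by exact_mod_cast Finset.le_sup (f := id) hmm)
    exact ⟨hgm.1.trans hmono, hgm.2.trans hmono⟩
  refine ⟨R, R, fun y hy => ?_⟩
  -- ## 2. Iwasawa `y = κ b`, `B = ψ b` upper triangular unitary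
  obtain ⟨κ₁, hκK₁, b₁, hyb₁⟩ := exists_mem_cmLocalIntegralLevel_mul_borel L 3 v y
  have hbB := (mem_borelU_iff _).1 b₁.2
  obtain ⟨κ, hκ⟩ : ∃ κ : ((cmDatum L 3 (Matrix.of fun i j : Fin 3 => if i.val + j.val + 1 = 3 then (1 : L) else 0)).Local v), κ = κ₁ := ⟨_, rfl⟩
  obtain ⟨b, hb⟩ : ∃ b : ((cmDatum L 3 (Matrix.of fun i j : Fin 3 => if i.val + j.val + 1 = 3 then (1 : L) else 0)).Local v), b = (b₁ : ↥(unitaryGroupOfForm (conjLocal L (IsCMField.complexConj L) v) (cmLocalForm L 3 v))) := ⟨_, rfl⟩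
  have hκK : κ ∈ cmLocalIntegralLevel L 3 (Matrix.of fun i j : Fin 3 => if i.val + j.val + 1 = 3 then (1 : L) else 0) v := by rw [hκ]; exact hκK₁
  have hyb : y = κ * b := by rw [hκ, hb]; exact hyb₁
  have hb10 : ((ψ b : GL (Fin 3) (w.1.adicCompletion L)) : Matrix (Fin 3) (Fin 3) (w.1.adicCompletion L)) 1 0 = 0 := by
    rw [hψentry, hb]; exact (congrFun (hbB (show id (0 : Fin 3) < id (1 : Fin 3) by decide)) w).trans rfl
  have hb20 : ((ψ b : GL (Fin 3) (w.1.adicCompletion L)) : Matrix (Fin 3) (Fin 3) (w.1.adicCompletion L)) 2 0 = 0 := by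
    rw [hψentry, hb]; exact (congrFun (hbB (show id (0 : Fin 3) < id (2 : Fin 3) by decide)) w).trans rfl
  have hb21 : ((ψ b : GL (Fin 3) (w.1.adicCompletion L)) : Matrix (Fin 3) (Fin 3) (w.1.adicCompletion L)) 2 1 = 0 := by
    rw [hψentry, hb]; exact (congrFun (hbB (show id (1 : Fin 3) < id (2 : Fin 3) by decide)) w).trans rfl
  obtain ⟨h2200, h1111⟩ := diag_rel_of_upper_mem_unitaryGroupOfForm (galAdicCompletionMap (L := L) (IsCMField.complexConj L) hw) (hψU b) hb10 hb20 hb21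
  -- abbreviate the diagonal entries
  obtain ⟨B₀, hB₀⟩ : ∃ B₀ : (w.1.adicCompletion L), B₀ = ((ψ b : GL (Fin 3) (w.1.adicCompletion L)) : Matrix (Fin 3) (Fin 3) (w.1.adicCompletion L)) 0 0 := ⟨_, rfl⟩
  obtain ⟨B₁, hB₁⟩ : ∃ B₁ : (w.1.adicCompletion L), B₁ = ((ψ b : GL (Fin 3) (w.1.adicCompletion L)) : Matrix (Fin 3) (Fin 3) (w.1.adicCompletion L)) 1 1 := ⟨_, rfl⟩
  obtain ⟨B₂, hB₂⟩ : ∃ B₂ : (w.1.adicCompletion L), B₂ = ((ψ b : GL (Fin 3) (w.1.adicCompletion L)) : Matrix (Fin 3) (Fin 3) (w.1.adicCompletion L)) 2 2 := ⟨_, rfl⟩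
  rw [← hB₀, ← hB₂] at h2200
  rw [← hB₁] at h1111
  have hB₀0 : B₀ ≠ 0 := fun h => by rw [h, mul_zero] at h2200; exact zero_ne_one h2200
  have hB₂0 : B₂ ≠ 0 := fun h => by rw [h, map_zero, zero_mul] at h2200; exact zero_ne_one h2200
  have hB₁0 : B₁ ≠ 0 := fun h => by rw [h, mul_zero] at h1111; exact zero_ne_one h1111
  have hB₂eq : B₂ = ((galAdicCompletionMap (L := L) (IsCMField.complexConj L) hw) B₀)⁻¹ := by
    have h := congrArg (galAdicCompletionMap (L := L) (IsCMField.complexConj L) hw) h2200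
    rw [map_mul, hσσ, map_one] at h
    exact eq_inv_of_mul_eq_one_left h
  obtain ⟨n₀, hn₀⟩ := hexp_of_ne hB₀0
  have hvB₁ : Valued.v B₁ = 1 := by
    obtain ⟨n₁, hn₁⟩ := hexp_of_ne hB₁0
    have h := congrArg Valued.v h1111
    rw [map_mul, hvσ, map_one, hn₁, ← WithZero.exp_add, ← WithZero.exp_zero] at h
    have := WithZero.exp_injective h
    rw [hn₁, ← WithZero.exp_zero]; congr 1; omega
  -- ## 3. `B = D · N′`, `N′ = m_κ · n(a,s)` (★ REG-FRAME)
  obtain ⟨dD, hdD, hdD'⟩ := exists_units_coe_eq_torusElt (galAdicCompletionMap (L := L) (IsCMField.complexConj L) hw) hB₀0  -- placeholder to get a GL; replaced below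
  clear dD hdD hdD'
  have h1D : Matrix.diagonal ![B₀, B₁, B₂] * Matrix.diagonal ![B₀⁻¹, B₁⁻¹, B₂⁻¹] = 1 := by
    rw [Matrix.diagonal_mul_diagonal, ← Matrix.diagonal_one]
    congr 1; funext i; fin_cases i <;> simp [mul_inv_cancel₀ hB₀0, mul_inv_cancel₀ hB₁0, mul_inv_cancel₀ hB₂0]
  have h2D : Matrix.diagonal ![B₀⁻¹, B₁⁻¹, B₂⁻¹] * Matrix.diagonal ![B₀, B₁, B₂] = 1 := by
    rw [Matrix.diagonal_mul_diagonal, ← Matrix.diagonal_one]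
    congr 1; funext i; fin_cases i <;> simp [inv_mul_cancel₀ hB₀0, inv_mul_cancel₀ hB₁0, inv_mul_cancel₀ hB₂0]
  obtain ⟨dD, hdD, hdD'⟩ : ∃ dD : GL (Fin 3) (w.1.adicCompletion L), (dD : Matrix (Fin 3) (Fin 3) (w.1.adicCompletion L)) = Matrix.diagonal ![B₀, B₁, B₂] ∧
      ((dD⁻¹ : GL (Fin 3) (w.1.adicCompletion L)) : Matrix (Fin 3) (Fin 3) (w.1.adicCompletion L)) = Matrix.diagonal ![B₀⁻¹, B₁⁻¹, B₂⁻¹] := ⟨⟨_, _, h1D, h2D⟩, rfl, rfl⟩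
  have hdDU : dD ∈ unitaryGroupOfForm (galAdicCompletionMap (L := L) (IsCMField.complexConj L) hw) ((StdForm.antidiagonal 3).over (w.1.adicCompletion L)) := by
    refine (diagonal_mem_unitaryGroupOfForm_three_iff (galAdicCompletionMap (L := L) (IsCMField.complexConj L) hw) hdD).2 ⟨?_, h1111, h2200⟩
    have h := congrArg (galAdicCompletionMap (L := L) (IsCMField.complexConj L) hw) h2200
    rw [map_mul, hσσ, map_one] at h
    rw [mul_comm]; exact h
  -- `N′ := dD⁻¹ · ψ b`, upper unitriangular
  have hN' : (((dD⁻¹ * ψ b : GL (Fin 3) (w.1.adicCompletion L))) : Matrix (Fin 3) (Fin 3) (w.1.adicCompletion L)) =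
      !![1, B₀⁻¹ * ((ψ b : GL (Fin 3) (w.1.adicCompletion L)) : Matrix (Fin 3) (Fin 3) (w.1.adicCompletion L)) 0 1, B₀⁻¹ * ((ψ b : GL (Fin 3) (w.1.adicCompletion L)) : Matrix (Fin 3) (Fin 3) (w.1.adicCompletion L)) 0 2;
         0, 1, B₁⁻¹ * ((ψ b : GL (Fin 3) (w.1.adicCompletion L)) : Matrix (Fin 3) (Fin 3) (w.1.adicCompletion L)) 1 2; 0, 0, 1] := by
    rw [Units.val_mul, hdD']
    ext i j
    fin_cases i <;> fin_cases j <;> simp [Matrix.mul_apply, Matrix.diagonal, hb10, hb20, hb21, ← hB₀, ← hB₁, ← hB₂, inv_mul_cancel₀ hB₀0, inv_mul_cancel₀ hB₁0, inv_mul_cancel₀ hB₂0]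
  have hN'U : dD⁻¹ * ψ b ∈ unitaryGroupOfForm (galAdicCompletionMap (L := L) (IsCMField.complexConj L) hw) ((StdForm.antidiagonal 3).over (w.1.adicCompletion L)) := mul_mem (inv_mem hdDU) (hψU b)
  obtain ⟨m, n, κ', a, s, hσκ, hσa, hσs, -, -, hm, hn, hmn⟩ := exists_transversal_mul_regCent_of_mem (galAdicCompletionMap (L := L) (IsCMField.complexConj L) hw) hσσ h2K hξ hξ0 hN' hN'U
  -- ## 4. The level `j` and the integral unitary `k′ = dD · d^{-j}`
  obtain ⟨j, hj⟩ : ∃ j : ℤ, j = -n₀ := ⟨_, rfl⟩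
  have hdz : ∀ i : ℤ, ((d ^ i : GL (Fin 3) (w.1.adicCompletion L)) : Matrix (Fin 3) (Fin 3) (w.1.adicCompletion L)) = Matrix.diagonal ![z ^ i, 1, (((galAdicCompletionMap (L := L) (IsCMField.complexConj L) hw) z) ^ i)⁻¹] :=
    fun i => coe_torusElt_zpow (galAdicCompletionMap (L := L) (IsCMField.complexConj L) hw) hz0 hd i
  have hk'coe : ((dD * d ^ (-j) : GL (Fin 3) (w.1.adicCompletion L)) : Matrix (Fin 3) (Fin 3) (w.1.adicCompletion L)) = Matrix.diagonal ![B₀ * z ^ (-j), B₁, B₂ * (((galAdicCompletionMap (L := L) (IsCMField.complexConj L) hw) z) ^ (-j))⁻¹] := by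
    rw [Units.val_mul, hdD, hdz, Matrix.diagonal_mul_diagonal]
    congr 1; funext i; fin_cases i <;> simp
  have hvzj : Valued.v (z ^ (-j)) = WithZero.exp (-n₀) := by
    rw [map_zpow₀, hz, ← WithZero.exp_zsmul, smul_eq_mul, hj]; congr 1; ring
  have hσz0 : (galAdicCompletionMap (L := L) (IsCMField.complexConj L) hw) z ≠ 0 := (map_ne_zero _).2 hz0
  have hvB₂ : Valued.v B₂ = WithZero.exp (-n₀) := by rw [hB₂eq, map_inv₀, hvσ, hn₀, WithZero.exp_neg]
  have hp : Valued.v (B₀ * z ^ (-j)) ≤ 1 := by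
    rw [map_mul, hn₀, hvzj, ← WithZero.exp_add, add_neg_cancel, WithZero.exp_zero]
  have hq : Valued.v B₁ ≤ 1 := hvB₁.le
  have hr : Valued.v (B₂ * (((galAdicCompletionMap (L := L) (IsCMField.complexConj L) hw) z) ^ (-j))⁻¹) ≤ 1 := by
    rw [map_mul, map_inv₀, map_zpow₀, hvσ, hvB₂, hz, ← WithZero.exp_zsmul, smul_eq_mul, ← WithZero.exp_neg, ← WithZero.exp_add, hj,
      ← WithZero.exp_zero]
    apply le_of_eq; congr 1; ring
  have hk'int : IsIntMatrix ((dD * d ^ (-j) : GL (Fin 3) (w.1.adicCompletion L)) : Matrix (Fin 3) (Fin 3) (w.1.adicCompletion L)) := by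
    rw [hk'coe]
    intro i i'
    by_cases hii : i = i'
    · subst hii
      rw [Matrix.diagonal_apply_eq]
      fin_cases i
      · simpa using hp
      · simpa using hq
      · simpa using hr
    · rw [Matrix.diagonal_apply_ne _ hii, map_zero]; exact zero_le
  obtain ⟨kk, hkk⟩ := hψsurj (dD * d ^ (-j)) (mul_mem hdDU (zpow_mem hdU _))
  have hkkK : kk ∈ cmLocalIntegralLevel L 3 (Matrix.of fun i j : Fin 3 => if i.val + j.val + 1 = 3 then (1 : L) else 0) v := by rw [hψK, hkk]; exact hk'int
  -- ## 5. The witnesses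
  refine ⟨κ * kk, kk⁻¹ * b, j, κ', a, s, m, n, (cmLocalIntegralLevel L 3 (Matrix.of fun i j : Fin 3 => if i.val + j.val + 1 = 3 then (1 : L) else 0) v).mul_mem hκK hkkK, ?_, ?_, hm, hn, hσκ, hσa, hσs, ?_, ?_⟩
  · rw [hyb]; group
  · -- `ψ (kk⁻¹ b) = d^j · m · n`
    rw [← hψe, hψmul, hψinv, hkk]
    have e : (dD * d ^ (-j))⁻¹ * ψ b = d ^ j * (dD⁻¹ * ψ b) := by rw [_root_.mul_inv_rev, _root_.zpow_neg, inv_inv]; group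
    rw [e, hmn, mul_assoc]
  · -- ## 6. The bounds: `ψ(b γ₀ b⁻¹) = dD · (m u₀ m⁻¹) · dD⁻¹ ∈ ψ(K C K)`
    -- (shared with the last goal; proved once below via `suffices`)
    have hx : b * γ₀ * b⁻¹ ∈ (cmLocalIntegralLevel L 3 (Matrix.of fun i j : Fin 3 => if i.val + j.val + 1 = 3 then (1 : L) else 0) v : Set ((cmDatum L 3 (Matrix.of fun i j : Fin 3 => if i.val + j.val + 1 = 3 then (1 : L) else 0)).Local v)) * C * (cmLocalIntegralLevel L 3 (Matrix.of fun i j : Fin 3 => if i.val + j.val + 1 = 3 then (1 : L) else 0) v : Set ((cmDatum L 3 (Matrix.of fun i j : Fin 3 => if i.val + j.val + 1 = 3 then (1 : L) else 0)).Local v)) := by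
      have e : b * γ₀ * b⁻¹ = κ⁻¹ * (y * γ₀ * y⁻¹) * κ := by rw [hyb]; group
      rw [e]; exact Set.mul_mem_mul (Set.mul_mem_mul ((cmLocalIntegralLevel L 3 (Matrix.of fun i j : Fin 3 => if i.val + j.val + 1 = 3 then (1 : L) else 0) v).inv_mem hκK) hy) hκK
    have hconj : ((ψ (b * γ₀ * b⁻¹) : GL (Fin 3) (w.1.adicCompletion L)) : Matrix (Fin 3) (Fin 3) (w.1.adicCompletion L)) =
        !![1, B₀ * 1 * B₁⁻¹, B₀ * (-t₀ - 2 * κ' * ξ) * B₂⁻¹; 0, 1, B₁ * (-1) * B₂⁻¹; 0, 0, 1] := by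
      obtain ⟨-, hcomm⟩ := regCentElt_mem_and_commute (galAdicCompletionMap (L := L) (IsCMField.complexConj L) hw) hσσ h2K hσa hσs hψγ₀ hn
      have hψb : ψ b = dD * (m * n) := by
        have := congrArg (fun g : GL (Fin 3) (w.1.adicCompletion L) => dD * g) hmn
        simpa only [mul_inv_cancel_left] using this
      have e1 : ψ (b * γ₀ * b⁻¹) = dD * (m * ψ γ₀ * m⁻¹) * dD⁻¹ := by
        rw [hψmul, hψmul, hψinv, hψb]
        have : m * n * ψ γ₀ * (m * n)⁻¹ = m * ψ γ₀ * m⁻¹ := by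
          rw [_root_.mul_inv_rev, show m * n * ψ γ₀ = m * (ψ γ₀ * n) by rw [mul_assoc, hcomm]]; group
        rw [show dD * (m * n) * ψ γ₀ * (dD * (m * n))⁻¹ = dD * (m * n * ψ γ₀ * (m * n)⁻¹) * dD⁻¹ by group, this]
      rw [e1]
      obtain ⟨mu, hmu⟩ : ∃ mu : GL (Fin 3) (w.1.adicCompletion L), mu = m * ψ γ₀ * m⁻¹ := ⟨_, rfl⟩
      have hmucoe : (mu : Matrix (Fin 3) (Fin 3) (w.1.adicCompletion L)) = !![1, 1, -t₀ - 2 * κ' * ξ; 0, 1, -1; 0, 0, 1] := by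
        rw [hmu]; exact coe_transversal_conj_regularUnipotent hm hψγ₀
      rw [← hmu]
      exact coe_diagonal_conj_upperTriangularUnipotent hB₀0 hB₁0 hB₂0 hdD hmucoe
    obtain ⟨h01, -⟩ := hR _ hx
    rw [hconj] at h01
    simp only [Matrix.of_apply, Matrix.cons_val', Matrix.cons_val_zero, Matrix.cons_val_one, Matrix.empty_val', Matrix.cons_val_fin_one,
      mul_one] at h01
    rw [map_mul, map_inv₀, hvB₁, inv_one, mul_one, hn₀, WithZero.exp_le_exp] at h01
    omega
  · have hx : b * γ₀ * b⁻¹ ∈ (cmLocalIntegralLevel L 3 (Matrix.of fun i j : Fin 3 => if i.val + j.val + 1 = 3 then (1 : L) else 0) v : Set ((cmDatum L 3 (Matrix.of fun i j : Fin 3 => if i.val + j.val + 1 = 3 then (1 : L) else 0)).Local v)) * C * (cmLocalIntegralLevel L 3 (Matrix.of fun i j : Fin 3 => if i.val + j.val + 1 = 3 then (1 : L) else 0) v : Set ((cmDatum L 3 (Matrix.of fun i j : Fin 3 => if i.val + j.val + 1 = 3 then (1 : L) else 0)).Local v)) := by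
      have e : b * γ₀ * b⁻¹ = κ⁻¹ * (y * γ₀ * y⁻¹) * κ := by rw [hyb]; group
      rw [e]; exact Set.mul_mem_mul (Set.mul_mem_mul ((cmLocalIntegralLevel L 3 (Matrix.of fun i j : Fin 3 => if i.val + j.val + 1 = 3 then (1 : L) else 0) v).inv_mem hκK) hy) hκK
    have hconj : ((ψ (b * γ₀ * b⁻¹) : GL (Fin 3) (w.1.adicCompletion L)) : Matrix (Fin 3) (Fin 3) (w.1.adicCompletion L)) =
        !![1, B₀ * 1 * B₁⁻¹, B₀ * (-t₀ - 2 * κ' * ξ) * B₂⁻¹; 0, 1, B₁ * (-1) * B₂⁻¹; 0, 0, 1] := by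
      obtain ⟨-, hcomm⟩ := regCentElt_mem_and_commute (galAdicCompletionMap (L := L) (IsCMField.complexConj L) hw) hσσ h2K hσa hσs hψγ₀ hn
      have hψb : ψ b = dD * (m * n) := by
        have := congrArg (fun g : GL (Fin 3) (w.1.adicCompletion L) => dD * g) hmn
        simpa only [mul_inv_cancel_left] using this
      have e1 : ψ (b * γ₀ * b⁻¹) = dD * (m * ψ γ₀ * m⁻¹) * dD⁻¹ := by
        rw [hψmul, hψmul, hψinv, hψb]
        have : m * n * ψ γ₀ * (m * n)⁻¹ = m * ψ γ₀ * m⁻¹ := by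
          rw [_root_.mul_inv_rev, show m * n * ψ γ₀ = m * (ψ γ₀ * n) by rw [mul_assoc, hcomm]]; group
        rw [show dD * (m * n) * ψ γ₀ * (dD * (m * n))⁻¹ = dD * (m * n * ψ γ₀ * (m * n)⁻¹) * dD⁻¹ by group, this]
      rw [e1]
      obtain ⟨mu, hmu⟩ : ∃ mu : GL (Fin 3) (w.1.adicCompletion L), mu = m * ψ γ₀ * m⁻¹ := ⟨_, rfl⟩
      have hmucoe : (mu : Matrix (Fin 3) (Fin 3) (w.1.adicCompletion L)) = !![1, 1, -t₀ - 2 * κ' * ξ; 0, 1, -1; 0, 0, 1] := by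
        rw [hmu]; exact coe_transversal_conj_regularUnipotent hm hψγ₀
      rw [← hmu]
      exact coe_diagonal_conj_upperTriangularUnipotent hB₀0 hB₁0 hB₂0 hdD hmucoe
    obtain ⟨-, h02⟩ := hR _ hx
    rw [hconj] at h02
    simp only [Matrix.of_apply, Matrix.cons_val', Matrix.cons_val_zero, Matrix.cons_val_two, Matrix.tail_cons, Matrix.head_cons, Matrix.empty_val',
      Matrix.cons_val_fin_one] at h02
    rw [map_mul, map_mul, map_inv₀, hn₀, hvB₂, show -t₀ - 2 * κ' * ξ = -(t₀ + 2 * κ' * ξ) by ring, Valuation.map_neg] at h02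
    -- `exp n₀ * v(…) * (exp (-n₀))⁻¹ ≤ exp R` ⇒ `v(…) ≤ exp (R + 2j)` with `j = -n₀`
    rcases eq_or_ne (t₀ + 2 * κ' * ξ) 0 with h0 | h0
    · rw [h0, map_zero]; exact zero_le
    · obtain ⟨e, he⟩ := hexp_of_ne h0
      rw [he, ← WithZero.exp_neg, neg_neg, ← WithZero.exp_add, ← WithZero.exp_add, WithZero.exp_le_exp] at h02
      rw [he, WithZero.exp_le_exp, hj]
      omega

end Literature.NumberTheory.Rogawski1990

end
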